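import Literature.NumberTheory.EllipticCurves.HeightCovolumeBoundsWatkinsLemmaProofs
import Literature.NumberTheory.EllipticCurves.ModularDegreeFormulaProofs
import Mathlib.Analysis.Complex.ExponentialBounds
import Mathlib.Tactic.Simproc.Factors
import HarnessLib

/-!
# Watkins (2004), Theorem 5.2 (`deg φ_E ≥ N^{7/6}/(10300 log N √(0.02 + log log N))`): the
# proved reductions and the trivial range

Companion to `Literature/NumberTheory/EllipticCurves/HeightCovolumeBounds.lean`, which vendors the
last inequality of M. Watkins, *Explicit lower bounds on the modular degree of an elliptic curve*,
arXiv:math/0408126 (2004), Theorem 5.2, verbatim, as the named fact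
`Literature.NumberTheory.EllipticCurves.watkins2004_thm_5_2` (all `E/ℚ`, `N ≥ 20000`, any
modular parametrisation datum `D` at level `N_E`). The fact is NOT discharged here; this file
records, sorry-free, the part of the printed argument the tree can carry and isolates what it
cannot.

## The printed proof (arXiv text pp. 3–10, read in full) and the tree

1. §1, Shimura's identity: `deg φ = (N c²/(2πΩ)) · L(Sym² E, 1) · ∏_{p²∣N} U_p(1)⁻¹`, `Ω` the
   area of the period parallelogram, `c ∈ ℤ` the Manin constant. With Zagier's formula
   `4π² c² (f, f) = deg · covol(Λ)` (PROVED in the tree,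
   `ModularForms.ModularParametrizationData.zagier_degree_formula_holds`) this is the Rankin–Selberg
   evaluation `(f, f) = (N/8π³) L(Sym² E, 1) ∏ U_p(1)⁻¹`; the tree has no `L(Sym² E, s)` at all.
2. `c² ≥ 1` (§4): in the tree (`c : ℤ`, `maninConstant_ne_zero_holds`).
3. Lemma 2.1, `1/Ω ≥ D^{1/6}/14.045`: PROVED (`watkins2004_lemma_2_1_holds`); `D = |Δ| ≥ N` for a
   global minimal model: PROVED (`conductorNorm_le_abs_Δ`).
4. Lemma 3.4, `L(Sym² f_E, 1) ≥ 0.033/log N⁽²⁾` for `N⁽²⁾ ≥ 142`, from the explicit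
   Goldfeld–Hoffstein–Lieman region (Lemma 3.1: continuation and functional equation of
   `ζ² L(Sym² f)³ L(Sym⁴ f)` — Gelbart–Jacquet, Kim–Shahidi — and its double pole — Bump–Ginzburg),
   the CM case (Lemma 3.3) and Rademacher's Phragmén–Lindelöf bounds: ABSENT (a theory).
5. §4: the factors `U_p(1)⁻¹` via global minimal twists (Watkins 2002), the estimate
   `∏_{p²∣N, p≡1 (3)} (1 − 1/p) ≥ e^{0.33}/√(0.02 + log log N)` for `N ≥ 20000` (explicit Mertens
   in the progression `1 mod 3`), and the comparison under twisting: ABSENT.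
6. Glue: `log N⁽²⁾ ≤ 2 log N`, `1/(2 · 5150) = 1/10300`; all constants descend from
   `2675 = ⌈2π · 14.045/0.033⌉`, so the last inequality of Theorem 5.2 carries the `2π` of (1)
   (unlike the first displays of §4 and of Theorem 5.1, cf. `HeightCovolumeBoundsProofs.lean`).

Two remarks on the source, for the record. (a) §1 asserts "`N ≥ 20000` (and thus `N⁽²⁾ ≥ 142`)",
but `N⁽²⁾` is invariant under quadratic twist: the twists of `11a` by `d ≥ 43` have
`N = 11d² ≥ 20000` and `N⁽²⁾ = 11² = 121 < 142`, so Lemmas 3.1–3.4 as printed do not cover them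
(the inequality itself holds there with enormous room). (b) The preprint is unrefereed (2004;
cited since only as arXiv:math/0408126).

## What is proved here

* `ModularParametrizationData.four_pi_sq_mul_peterssonProduct_re_mul_rpow_le` (steps 1–3 in the
  tree's language, model-free): for EVERY Weierstrass model `W/ℚ` and every datum `D` at any level,
  `4π² (f, f) · |Δ(W)|^{1/6} / 14.045 ≤ deg` (Zagier, `c² ≥ 1`, Lemma 2.1). This is the exact
  socket for the missing analytic input: an explicit lower bound for `(f, f)` (equivalently for
  `L(Sym² E, 1) ∏ U_p(1)⁻¹`) of size `≍ N/log N` turns it into Theorem 5.2.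
  (For a globally minimal model, `|Δ(W)| ≥ N_E` — `conductorNorm_le_abs_Δ` of
  `HeightCovolumeBoundsProofs.lean` — turns `|Δ(W)|^{1/6}` into `N^{1/6}`.) Theorem 5.2 would follow
  from any explicit bound `(f, f) ≥ 14.045 · N/(4π² · 10300 · log N · √(0.02 + log log N))`, but
  that is NOT what the source proves prime by prime (at `p ≡ 5 (12)`, `2`, `3` Watkins compensates
  a small `U_p(1)⁻¹` by `D_p > N_p`), so no such conditional is recorded as a reduction of the fact.
* `watkins2004_thm_5_2.bound_lt_one`: for real `20000 ≤ N ≤ 28000` the right-hand side of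
  Theorem 5.2 is `< 1` (certified: `log 20000 ≥ 9.9`, `log 9.9 ≥ 2.29`, `28000^{1/6} ≤ 5.511`),
  whence `watkins2004_thm_5_2.of_conductorNorm_le`: the conclusion of `watkins2004_thm_5_2` for
  `20000 ≤ N_E ≤ 28000`, from `deg ≥ 1` alone (the bound crosses `1` near `N = 29300`; Watkins,
  Remark 5.3: it exceeds `N` only for `N ≥ e^{86.8}`).

Not provable by elementary means, for the record: from the strip `{y > 1/N}` (which injects into
`Γ₀(N)∖ℍ`, `PeterssonNormLowerBoundProofs.lean`) and `a_p²/p + a_{p²}²/p² ≥ 3/4` for good `p`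
(`a_{p²} = a_p² − p`) one only gets `(f, f) ≫ √N/log N`, i.e. `deg ≫ N^{2/3}/log N`, short of
`N^{7/6}/log N` by `√N`; the gap is exactly Rankin–Selberg/Sato–Tate-strength information on
`∑_{p ≤ N} a_p²/p`.

## References

* [Watkins2004] M. Watkins, *Explicit lower bounds on the modular degree of an elliptic curve*,
  arXiv:math/0408126 — §1, Lemma 2.1, Lemmas 3.1–3.4, §4, Theorem 5.2, Remark 5.3.
* [ZagierCMB1985] D. Zagier, *Modular parametrizations of elliptic curves*, Canad. Math. Bull. 28
  (1985), §1.
-/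

noncomputable section

open Literature.NumberTheory.EllipticCurves.ModularForms CongruenceSubgroup

namespace Literature.NumberTheory.EllipticCurves

/-- **Steps 1–3 of the proof of [Watkins2004], Thm. 5.2, in the tree's language (model-free).**
For every Weierstrass model `W/ℚ` and every modular parametrisation datum `D` of `W` at level `N`,
`4π² (f, f) · |Δ(W)|^{1/6} / 14.045 ≤ deg`: by `4π² (f, f) ≤ deg · covol(Λ)` (Zagier's formula
`(f, f) = deg · covol(Λ)/(4π²c²)`, `zagier_degree_formula_holds`, and `c² ≥ 1` for the integer
`c ≠ 0`, `maninConstant_ne_zero_holds`; Watkins §4: "for the Manin constant we simply use the fact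
that `c ≥ 1`"; cf. `four_pi_sq_mul_peterssonProduct_re_le_deg_mul_covolume`) and Lemma 2.1
`covol(Λ) · |Δ(W)|^{1/6} ≤ 14.045` (`watkins2004_lemma_2_1_holds`). Watkins' own form of this step
is `deg φ ≥ (N/(2πΩ)) L(Sym² E,1) ∏ U_p(1)⁻¹ ≥ N D^{1/6} L(Sym² E,1) ∏ U_p(1)⁻¹/(2π · 14.045)`
(§4, first two displays, with the `2π` of §1 restored); the two agree through
`(f, f) = (N/8π³) L(Sym² E, 1) ∏ U_p(1)⁻¹`, which the tree does not have.
[cite: Watkins2004, §4 (first two displays) with §1 and Lemma 2.1] -/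
theorem ModularForms.ModularParametrizationData.four_pi_sq_mul_peterssonProduct_re_mul_rpow_le
    {N : ℕ} [NeZero N] {W : WeierstrassCurve ℚ} [W.IsElliptic]
    (D : ModularParametrizationData W N) :
    4 * Real.pi ^ 2 * (peterssonProduct (Gamma0 N) 2 D.f D.f).re *
        ((|W.Δ| : ℚ) : ℝ) ^ (1 / 6 : ℝ) / 14.045 ≤ (D.modularDegree : ℝ) := by
  -- `4π² (f,f) ≤ deg · covol` (Zagier and `c² ≥ 1`), then Lemma 2.1: `covol · |Δ|^{1/6} ≤ 14.045`
  have h4P : 4 * Real.pi ^ 2 * (peterssonProduct (Gamma0 N) 2 D.f D.f).re ≤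
      (D.modularDegree : ℝ) * ZLattice.covolume D.L.lattice := by
    have hZ := D.zagier_degree_formula_holds.peterssonProduct_eq
    have hc1 : (1 : ℝ) ≤ (D.c : ℝ) ^ 2 := by
      have h : (1 : ℤ) ≤ D.c ^ 2 :=
        (one_le_sq_iff_one_le_abs _).mpr (Int.one_le_abs D.maninConstant_ne_zero_holds)
      exact_mod_cast h
    have hc2 : 0 < (D.c : ℝ) ^ 2 := lt_of_lt_of_le one_pos hc1
    have hcov0 : 0 < ZLattice.covolume D.L.lattice := ZLattice.covolume_pos D.L.lattice _
    have hdeg0 : (0 : ℝ) ≤ (D.deg : ℝ) := Nat.cast_nonneg _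
    have h' : 4 * Real.pi ^ 2 * (peterssonProduct (Gamma0 N) 2 D.f D.f).re =
        D.deg * ZLattice.covolume D.L.lattice / (D.c : ℝ) ^ 2 := by
      rw [hZ, Complex.ofReal_re]
      field_simp
    rw [h', div_le_iff₀ hc2]
    exact le_mul_of_one_le_right (mul_nonneg hdeg0 hcov0.le) hc1
  have h21 := watkins2004_lemma_2_1_holds W D.L D.isNeronLattice
  set P : ℝ := (peterssonProduct (Gamma0 N) 2 D.f D.f).re with hP
  set cov : ℝ := ZLattice.covolume D.L.lattice with hcov
  set X : ℝ := ((|W.Δ| : ℚ) : ℝ) ^ (1 / 6 : ℝ) with hX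
  have hX0 : 0 ≤ X := Real.rpow_nonneg (by exact_mod_cast abs_nonneg W.Δ) _
  have hdeg0 : (0 : ℝ) ≤ (D.modularDegree : ℝ) := Nat.cast_nonneg _
  calc 4 * Real.pi ^ 2 * P * X / 14.045 ≤ D.modularDegree * cov * X / 14.045 := by gcongr
    _ = D.modularDegree * (cov * X) / 14.045 := by ring
    _ ≤ D.modularDegree * 14.045 / 14.045 := by gcongr
    _ = D.modularDegree := by rw [mul_div_assoc, div_self (by norm_num), mul_one]

/-- **The right-hand side of [Watkins2004], Thm. 5.2 is `< 1` for `20000 ≤ N ≤ 28000`.**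
Certified: `log N ≥ log 20000 ≥ 9.9` (`e^{9.9} ≤ 20000`), `log log N ≥ log 9.9 ≥ 2.29`
(`e^{2.29} ≤ 9.9`), `N^{7/6} = N · N^{1/6} ≤ 28000 · 5.511` (`28000 ≤ 5.511⁶`), so the bound is at
most `28000 · 5.511/(9.9 · 10300 · 1.5198) = 0.9957…`. (The bound crosses `1` near `N = 29300`;
Watkins, Remark 5.3, notes it exceeds `N` only for `N ≥ e^{86.8}`.) [cite: Watkins2004, Theorem 5.2 and Remark 5.3] -/
theorem watkins2004_thm_5_2.bound_lt_one {N : ℝ} (h1 : 20000 ≤ N) (h2 : N ≤ 28000) :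
    N ^ (7 / 6 : ℝ) / Real.log N * ((1 / 10300) / Real.sqrt (0.02 + Real.log (Real.log N))) < 1 := by
  have hN0 : 0 < N := by linarith
  have he1 := Real.exp_one_lt_d9
  -- `log N ≥ 9.9`
  have hlogN : (9.9 : ℝ) ≤ Real.log N := by
    rw [Real.le_log_iff_exp_le hN0]
    have h : Real.exp (9.9 : ℝ) = Real.exp 1 ^ 10 * (Real.exp 0.1)⁻¹ := by
      rw [← Real.exp_nat_mul, ← Real.exp_neg, ← Real.exp_add]; norm_num
    have h01 : (1.105 : ℝ) ≤ Real.exp 0.1 := by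
      have := Real.quadratic_le_exp_of_nonneg (show (0 : ℝ) ≤ 0.1 by norm_num)
      norm_num at this
      linarith
    have h10 : Real.exp 1 ^ 10 ≤ 2.7182818286 ^ 10 := pow_le_pow_left₀ (Real.exp_pos _).le he1.le 10
    rw [h]
    calc Real.exp 1 ^ 10 * (Real.exp 0.1)⁻¹ ≤ 2.7182818286 ^ 10 * (1.105 : ℝ)⁻¹ :=
          mul_le_mul h10 (inv_anti₀ (by norm_num) h01) (inv_pos.2 (Real.exp_pos _)).le
            (by positivity)
      _ ≤ 20000 := by norm_num
      _ ≤ N := h1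
  -- `log log N ≥ 2.29`
  have hloglog : (2.29 : ℝ) ≤ Real.log (Real.log N) := by
    have h99 : (0 : ℝ) < 9.9 := by norm_num
    refine le_trans ?_ (Real.log_le_log h99 hlogN)
    rw [Real.le_log_iff_exp_le h99]
    have h : Real.exp (2.29 : ℝ) = Real.exp 1 ^ 2 * Real.exp 0.29 := by
      rw [← Real.exp_nat_mul, ← Real.exp_add]; norm_num
    have h29 : Real.exp 0.29 ≤ 1.3365 := by
      have hb := Real.exp_bound' (x := (0.29 : ℝ)) (by norm_num) (by norm_num) (n := 5) (by norm_num)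
      simp only [Finset.sum_range_succ, Finset.sum_range_zero, Nat.factorial] at hb
      norm_num at hb
      linarith
    have h2' : Real.exp 1 ^ 2 ≤ 2.7182818286 ^ 2 := pow_le_pow_left₀ (Real.exp_pos _).le he1.le 2
    rw [h]
    calc Real.exp 1 ^ 2 * Real.exp 0.29 ≤ 2.7182818286 ^ 2 * 1.3365 :=
          mul_le_mul h2' h29 (Real.exp_pos _).le (by positivity)
      _ ≤ 9.9 := by norm_num
  -- `N^{7/6} ≤ 28000 · 5.511`
  have hpow : N ^ (7 / 6 : ℝ) ≤ 28000 * 5.511 := by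
    have h16 : N ^ (1 / 6 : ℝ) ≤ 5.511 := by
      have h6 : (28000 : ℝ) ≤ 5.511 ^ 6 := by norm_num
      calc N ^ (1 / 6 : ℝ) ≤ (28000 : ℝ) ^ (1 / 6 : ℝ) := Real.rpow_le_rpow hN0.le h2 (by norm_num)
        _ ≤ ((5.511 : ℝ) ^ 6) ^ (1 / 6 : ℝ) := Real.rpow_le_rpow (by norm_num) h6 (by norm_num)
        _ = 5.511 := by
            rw [show (1 / 6 : ℝ) = ((6 : ℕ) : ℝ)⁻¹ by norm_num,
              Real.pow_rpow_inv_natCast (by norm_num) (by norm_num)]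
    have hsplit : N ^ (7 / 6 : ℝ) = N * N ^ (1 / 6 : ℝ) := by
      rw [show (7 / 6 : ℝ) = 1 + 1 / 6 by norm_num, Real.rpow_add hN0, Real.rpow_one]
    rw [hsplit]
    exact mul_le_mul h2 h16 (Real.rpow_nonneg hN0.le _) (by norm_num)
  -- `√(0.02 + log log N) ≥ 1.5198`
  have hsqrt : (1.5198 : ℝ) ≤ Real.sqrt (0.02 + Real.log (Real.log N)) := by
    rw [show (1.5198 : ℝ) = Real.sqrt (1.5198 ^ 2) from (Real.sqrt_sq (by norm_num)).symm]
    exact Real.sqrt_le_sqrt (by nlinarith)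
  -- assembly
  have hlogpos : 0 < Real.log N := by linarith
  have hA : N ^ (7 / 6 : ℝ) / Real.log N ≤ 28000 * 5.511 / 9.9 :=
    div_le_div₀ (by norm_num) hpow (by norm_num) hlogN
  have hB : (1 / 10300 : ℝ) / Real.sqrt (0.02 + Real.log (Real.log N)) ≤ (1 / 10300) / 1.5198 :=
    div_le_div_of_nonneg_left (by norm_num) (by norm_num) hsqrt
  calc N ^ (7 / 6 : ℝ) / Real.log N * ((1 / 10300) / Real.sqrt (0.02 + Real.log (Real.log N)))
      ≤ 28000 * 5.511 / 9.9 * ((1 / 10300) / 1.5198) :=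
        mul_le_mul hA hB (by positivity) (by positivity)
    _ < 1 := by norm_num

/-- **[Watkins2004], Thm. 5.2 on the trivial range `20000 ≤ N_E ≤ 28000`.** For every `E/ℚ`
(any model `W`) with `20000 ≤ N_E ≤ 28000` and every modular parametrisation datum `D` at level
`N_E`, `N^{7/6}/log N · (1/10300)/√(0.02 + log log N) ≤ deg`, because the left-hand side is `< 1`
(`watkins2004_thm_5_2.bound_lt_one`) and `deg ≥ 1` (`deg_pos`). This is the conclusion of the
named fact `watkins2004_thm_5_2` restricted to that range; the fact itself (all `N ≥ 20000`) needs
the symmetric-square theory listed in the module docstring.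
[cite: Watkins2004, Theorem 5.2 (trivial range; cf. Remark 5.3)] -/
theorem watkins2004_thm_5_2.of_conductorNorm_le (W : WeierstrassCurve ℚ) [W.IsElliptic]
    [NeZero (W.conductorNorm ℤ)] (h1 : 20000 ≤ W.conductorNorm ℤ)
    (h2 : W.conductorNorm ℤ ≤ 28000) (D : ModularParametrizationData W (W.conductorNorm ℤ)) :
    (W.conductorNorm ℤ : ℝ) ^ (7 / 6 : ℝ) / Real.log (W.conductorNorm ℤ) *
        ((1 / 10300) / Real.sqrt (0.02 + Real.log (Real.log (W.conductorNorm ℤ)))) ≤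
      (D.modularDegree : ℝ) := by
  have hb := watkins2004_thm_5_2.bound_lt_one (N := (W.conductorNorm ℤ : ℝ))
    (by exact_mod_cast h1) (by exact_mod_cast h2)
  have hd1 : 1 ≤ D.modularDegree := D.deg_pos
  have hd : (1 : ℝ) ≤ (D.modularDegree : ℝ) := by exact_mod_cast hd1
  exact (hb.le).trans hd

/-! ### The prime-product step of [Watkins2004], §4 is false as printed (certified counterexample)

[Watkins2004], §4 (arXiv text p. 9), having reached
`deg φ ≥ N^{7/6}/(7150 log N⁽²⁾) · ∏_{p² ∣ N, p ≡ 1 (3)} (1 − 1/p)` for global minimal twists,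
continues: "We can estimate the product over primes using facts from prime number theory; for
`N ≥ 20000` the logarithm of the product is bounded by
`∑_{p²∣N, p≡1(3)} 1/p + ∑_p (1/2p²)/(1 − 1/p) ≤ ∑_{p ≤ 1.02 log N, p≡1(3)} 1/p + 0.02
 ≤ 0.5 log log(1.02 log N) − 0.33`, and so we have that
`deg φ ≥ N^{7/6}/(7150 log N⁽²⁾) · e^{0.33}/√(0.02 + log log N)
 ≥ (N^{7/6}/log N⁽²⁾) · (1/5150)/√(0.02 + log log N)`."
Theorem 5.2 then replaces `log N⁽²⁾` by `2 log N` (`N⁽²⁾ ≤ N²`, §3.1): `1/10300 = 1/(2 · 5150)`.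

The asserted bound `∏_{p²∣N, p≡1(3)} (1 − 1/p) ≥ e^{0.33}/√(0.02 + log log N)` (`N ≥ 20000`) is
FALSE: at `N = 24843 = 3 · 7² · 13²` the product is `(6/7)(12/13) = 72/91 = 0.7912…` while
`e^{0.33}/√(0.02 + log log 24843) = 0.9103…` (`watkins2004_sec4_primeProduct_bound_counterexample`).
(The prime-sum claim behind it, `∑_{p ≤ X, p≡1(3)} 1/p ≤ ½ log log X − 0.35`, is the Mertens
asymptotic for the progression — its constant is `M(3,1) = −0.3568…` — with no room for the
finite-`X` excess: numerically it fails for every `X < 265`, in particular for all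
`20000 ≤ N ≤ 10⁹`, and for most `X ≤ 503`; and the preceding comparison
`∑_{p²∣N, p≡1(3)} 1/p ≤ ∑_{p ≤ 1.02 log N, p≡1(3)} 1/p` already fails at `N = 24843`:
`1/7 + 1/13 > 1/7`.) Consequently the last "≥" in the display of Theorem 5.2 is not established by
the printed argument: with the only information on `N⁽²⁾` used there, `N⁽²⁾ ≤ N²`, the middle
expression is SMALLER than the last one at `N = 24843`, by the factor `0.87…`
(`watkins2004_thm_5_2.middle_lt_last_at_24843`).

What this does and does not say. It does NOT refute the vendored statement `watkins2004_thm_5_2`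
(the last inequality of Theorem 5.2 itself): at `N = 24843` that bound is `0.84… < 1 ≤ deg`
(`watkins2004_thm_5_2.of_conductorNorm_le` above), and in general the finer local bound
`N⁽²⁾_p ≤ p²` at the additive primes `p ≥ 5` (so that `log N⁽²⁾ ≤ 2 log N − 2 ∑_{p²∣N, p≥5} log p`,
a saving that is large exactly when the product is long) numerically restores `middle ≥ last` with
a margin of about `20 %` — but that repair is not in the source and rests on the local conductor
computation the paper only cites ([martin]). Together with remark (a) of the module docstring
(`N⁽²⁾ ≥ 142` is assumed in Lemmas 3.1–3.4 but fails e.g. for the quadratic twists of `11a`,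
`N = 11d² ≥ 20000`, `N⁽²⁾ = 121`), the printed proof of Theorem 5.2 has two gaps: the vendored
inequality is, as of this writing, an unrefereed CLAIM with an incomplete published argument —
very plausibly true, and true on `20000 ≤ N ≤ 28000` — not an established theorem. -/

/-- Numerical facts about `N = 24843`: `1 < log 24843` and `log log 24843 < 5/2` (from
`e < 24843 < e^{11}` with `2.7182818283 < e < 2.7182818286`, and `11 < e^{5/2} = e² · e^{1/2}`,
`e^{1/2} ≥ 3/2`). [folklore] -/
private theorem loglog_24843_bounds :
    1 < Real.log (24843 : ℝ) ∧ Real.log (Real.log (24843 : ℝ)) < 5 / 2 := by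
  have he1 := Real.exp_one_gt_d9
  have hy11 : Real.log (24843 : ℝ) < 11 := by
    rw [Real.log_lt_iff_lt_exp (by norm_num)]
    have : Real.exp 11 = Real.exp 1 ^ 11 := by
      rw [← Real.exp_nat_mul]; norm_num
    rw [this]
    calc (24843 : ℝ) < 2.7182818283 ^ 11 := by norm_num
      _ < Real.exp 1 ^ 11 := pow_lt_pow_left₀ he1 (by norm_num) (by norm_num)
  have hy1 : 1 < Real.log (24843 : ℝ) := by
    rw [Real.lt_log_iff_exp_lt (by norm_num)]
    calc Real.exp 1 < 2.7182818286 := Real.exp_one_lt_d9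
      _ < (24843 : ℝ) := by norm_num
  refine ⟨hy1, ?_⟩
  have hA : Real.log (Real.log (24843 : ℝ)) < Real.log 11 := Real.log_lt_log (by linarith) hy11
  have hB : Real.log 11 < 5 / 2 := by
    rw [Real.log_lt_iff_lt_exp (by norm_num)]
    have hsplit : Real.exp (5 / 2) = Real.exp 1 ^ 2 * Real.exp (1 / 2) := by
      rw [← Real.exp_nat_mul, ← Real.exp_add]; norm_num
    rw [hsplit]
    have hhalf : (1 / 2 : ℝ) + 1 ≤ Real.exp (1 / 2) := Real.add_one_le_exp _
    have hsq : (2.7182818283 : ℝ) ^ 2 < Real.exp 1 ^ 2 :=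
      pow_lt_pow_left₀ he1 (by norm_num) (by norm_num)
    nlinarith [Real.exp_pos (1 / 2 : ℝ)]
  exact hA.trans hB

/-- The primes `p` with `p² ∣ 24843` and `p ≡ 1 (mod 3)` are exactly `7` and `13`
(`24843 = 3 · 7² · 13²`; `Nat.primeFactorsList_ofNat` and `decide`). [folklore] -/
private theorem primeFactors_filter_24843 :
    ((24843 : ℕ).primeFactors.filter (fun p => p ^ 2 ∣ 24843 ∧ p % 3 = 1)) = {7, 13} := by
  simp only [← Nat.toFinset_factors, Nat.primeFactorsList_ofNat]
  decide

/-- **The prime-product bound of [Watkins2004], §4 is false as printed.** It is NOT the case that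
for every `N ≥ 20000`, `∏_{p² ∣ N, p ≡ 1 (3)} (1 − 1/p) ≥ e^{0.33}/√(0.02 + log log N)`: at
`N = 24843 = 3 · 7² · 13²` the left side is `(1 − 1/7)(1 − 1/13) = 72/91 < 1.33/1.5875
≤ e^{0.33}/√(0.02 + log log 24843)` (`e^{0.33} ≥ 1.33`, `log log 24843 < 5/2`, `√2.52 < 1.5875`).
The product runs over `N.primeFactors` filtered by `p² ∣ N ∧ p % 3 = 1`, i.e. the paper's index
set `{p prime : p² ∣ N, p ≡ 1 (3)}`. See the section docstring for what this does (and does not)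
imply for Theorem 5.2. [cite: Watkins2004, §4 (display "We can estimate the product over primes …", arXiv text p. 9)] -/
theorem watkins2004_sec4_primeProduct_bound_counterexample :
    ¬ ∀ N : ℕ, 20000 ≤ N →
      Real.exp 0.33 / Real.sqrt (0.02 + Real.log (Real.log N)) ≤
        ∏ p ∈ N.primeFactors with p ^ 2 ∣ N ∧ p % 3 = 1, (1 - 1 / (p : ℝ)) := by
  intro h
  have h1 := h 24843 (by norm_num)
  rw [primeFactors_filter_24843, Finset.prod_pair (by norm_num)] at h1
  simp only [Nat.cast_ofNat] at h1
  -- `h1 : exp 0.33 / √(0.02 + log log 24843) ≤ (1 - 1/7)(1 - 1/13)`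
  obtain ⟨hy1, hx52⟩ := loglog_24843_bounds
  have hx0 : 0 < Real.log (Real.log (24843 : ℝ)) := Real.log_pos hy1
  set x : ℝ := Real.log (Real.log (24843 : ℝ)) with hx
  have hsqrt : Real.sqrt (0.02 + x) < 1.5875 := by
    rw [Real.sqrt_lt' (by norm_num)]
    linarith
  have hsqrtpos : 0 < Real.sqrt (0.02 + x) := Real.sqrt_pos.mpr (by linarith)
  have hexp : (0.33 : ℝ) + 1 ≤ Real.exp 0.33 := Real.add_one_le_exp _
  have key : (1.33 : ℝ) / 1.5875 < Real.exp 0.33 / Real.sqrt (0.02 + x) := by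
    calc (1.33 : ℝ) / 1.5875 < 1.33 / Real.sqrt (0.02 + x) :=
          div_lt_div_of_pos_left (by norm_num) hsqrtpos hsqrt
      _ ≤ Real.exp 0.33 / Real.sqrt (0.02 + x) :=
          div_le_div_of_nonneg_right (by linarith) hsqrtpos.le
  have : (1.33 : ℝ) / 1.5875 < (1 - 1 / (7 : ℝ)) * (1 - 1 / (13 : ℝ)) := key.trans_le h1
  norm_num at this

/-- **The last "≥" of the display of [Watkins2004], Thm. 5.2 does not follow from `N⁽²⁾ ≤ N²`.**
Write `middle(N) = N^{7/6}/(7150 log N⁽²⁾) · ∏_{p²∣N, p≡1(3)} (1 − 1/p)` and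
`last(N) = (N^{7/6}/log N) · (1/10300)/√(0.02 + log log N)` for the second and third expressions
of the display of Theorem 5.2. The paper obtains `middle ≥ last` from the §4 product bound
(false: `watkins2004_sec4_primeProduct_bound_counterexample`) and `log N⁽²⁾ ≤ 2 log N`. With
`N⁽²⁾` replaced by that bound `N²` — the only information on `N⁽²⁾` the argument uses at this
point — the inequality FAILS at `N = 24843`: `N^{7/6}/(7150 log N²) · 72/91 < last(24843)`
(ratio `0.87…`), since `(72/91)/14300 = 18/325325 < 4/65405 = (1/10300)/1.5875
< (1/10300)/√(0.02 + log log 24843)`. (For the actual curves of conductor `24843` one has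
`N⁽²⁾ ≤ 3² 7² 13²`, and `middle ≥ last` holds with ratio `1.57…` — by an argument the source does
not give; and `last(24843) < 1 ≤ deg` anyway, `watkins2004_thm_5_2.of_conductorNorm_le`.)
[cite: Watkins2004, Theorem 5.2 (display), with §4 and §3.1 (`N⁽²⁾ ≤ N²`)] -/
theorem watkins2004_thm_5_2.middle_lt_last_at_24843 :
    ¬ ∀ N : ℕ, 20000 ≤ N →
      (N : ℝ) ^ (7 / 6 : ℝ) / Real.log N *
          ((1 / 10300) / Real.sqrt (0.02 + Real.log (Real.log N))) ≤
        (N : ℝ) ^ (7 / 6 : ℝ) / (7150 * Real.log ((N : ℝ) ^ 2)) *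
          ∏ p ∈ N.primeFactors with p ^ 2 ∣ N ∧ p % 3 = 1, (1 - 1 / (p : ℝ)) := by
  intro h
  have h1 := h 24843 (by norm_num)
  rw [primeFactors_filter_24843, Finset.prod_pair (by norm_num), Real.log_pow] at h1
  simp only [Nat.cast_ofNat] at h1
  obtain ⟨hy1, hx52⟩ := loglog_24843_bounds
  have hx0 : 0 < Real.log (Real.log (24843 : ℝ)) := Real.log_pos hy1
  set x : ℝ := Real.log (Real.log (24843 : ℝ)) with hx
  set L : ℝ := Real.log (24843 : ℝ) with hL
  set P : ℝ := (24843 : ℝ) ^ (7 / 6 : ℝ) with hP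
  have hLpos : 0 < L := by linarith
  have hPpos : 0 < P := Real.rpow_pos_of_pos (by norm_num) _
  have hPL : 0 < P / L := div_pos hPpos hLpos
  have hsqrt : Real.sqrt (0.02 + x) < 1.5875 := by
    rw [Real.sqrt_lt' (by norm_num)]
    linarith
  have hsqrtpos : 0 < Real.sqrt (0.02 + x) := Real.sqrt_pos.mpr (by linarith)
  -- right-hand side `= (P/L) · 18/325325`; left-hand side `> (P/L) · 4/65405`
  have hR : P / (7150 * (2 * L)) * ((1 - 1 / (7 : ℝ)) * (1 - 1 / 13)) = P / L * (18 / 325325) := by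
    field_simp
    ring
  have hc : (1 / 10300 : ℝ) / 1.5875 < (1 / 10300) / Real.sqrt (0.02 + x) :=
    div_lt_div_of_pos_left (by norm_num) hsqrtpos hsqrt
  have hlt : P / (7150 * (2 * L)) * ((1 - 1 / (7 : ℝ)) * (1 - 1 / 13)) <
      P / L * ((1 / 10300) / Real.sqrt (0.02 + x)) := by
    rw [hR]
    calc P / L * (18 / 325325) < P / L * ((1 / 10300 : ℝ) / 1.5875) :=
          mul_lt_mul_of_pos_left (by norm_num) hPL
      _ ≤ P / L * ((1 / 10300) / Real.sqrt (0.02 + x)) :=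
          mul_le_mul_of_nonneg_left hc.le hPL.le
  exact absurd h1 (not_le.mpr hlt)

end Literature.NumberTheory.EllipticCurves

end
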